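import Mathlib
import HarnessLib
import Literature.Computability.AlgebraicComplexity.PatternExpressions
import Summits.ValiantsHypothesis.ValiantsHypothesis.Theorems.MonotoneRestorationOrbitCompressionQPOneRowStratum

/-!
# Route MonotoneRestoration — aside `OrbitCompressionQP` (stmt-ValiantsHypothesis-18332), line
# `expression_compression`: the ENTRY-SYMMETRIC STRATUM in the expression currency

The tree's `qpSymmetric_of_entrySymmetric` (THEOREM ζ-G + Bläser–Jindal, `Theorems/…QPZetaEntrySymmetric*.lean`)
gives quasi-polynomial square-symmetric CIRCUITS for `VP` families symmetric in all `n²` entries.  In the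
currency of `stub_narrowExpressionCompression` the conclusion is stronger (quasi-polynomial-LENGTH narrow
EXPRESSIONS imply quasi-polynomial symmetric circuits by THEOREM ζ-P, not conversely), and it follows from the
`VQP` substitution principle with the all-entries Newton substituends `exists_fullEsymm`:

* `isVQPFamily_entrySymmetricCore` — the symmetric cores `P_n ∈ ℂ[y_0, …, y_{n²-1}]`
  (`P_n(e_1, …, e_{n²}) = h_n`, `e_j` of the `n²` entries) of a `VQP` family form a `VQP` family (Bläser–Jindal
  at `N = n²` variables, transported along `Fin n × Fin n ≃ Fin (n·n)`);
* ★ `narrowQP_entrySymmetric` — every `VQP` family `h_n ∈ ℂ[x_ij]^{S_{n²}}` satisfies the conclusion of the stub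
  (`(1,1)` labels).

Helper file (`--supports stmt-ValiantsHypothesis-18332`); def-free; nothing here is a named fact; no registered
stub is closed; VP ≠ VNP is not moved.
-/

noncomputable section

open MvPolynomial

-- `Summit.ValiantsHypothesis.ValiantsHypothesis.…` is the tree's single-conjunct layout (Sub = Summit).
set_option linter.dupNamespace false

namespace Summit.ValiantsHypothesis.ValiantsHypothesis.Theorems

namespace FormulaSubstitution

open Literature.Computability.AlgebraicComplexity

/-- **Entry-symmetric cores exist**: a polynomial symmetric in all `n²` entries is `P(e_1, …, e_{n²})` for
some `P ∈ ℂ[y_0, …, y_{n·n-1}]`. [folklore] -/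
theorem exists_entrySymmetricCore {n : ℕ} (h : MvPolynomial (Fin n × Fin n) ℂ) (hh : h.IsSymmetric) :
    ∃ P : MvPolynomial (Fin (n * n)) ℂ,
      aeval (fun j : Fin (n * n) => esymm (Fin n × Fin n) ℂ (j.val + 1)) P = h := by
  obtain ⟨P, hP⟩ := esymmAlgHom_surjective ℂ (σ := Fin n × Fin n) (n := n * n) (by simp) ⟨h, hh⟩
  refine ⟨P, ?_⟩
  have := congrArg Subtype.val hP
  rwa [esymmAlgHom_apply] at this

/-- Transport of the core equation along `e : Fin n × Fin n ≃ Fin (n·n)`: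
`P(e_1, …, e_N)` over `Fin (n·n)` variables is the renaming of `P(e_1, …, e_N)` over the entries. [folklore] -/
theorem rename_core_eq {n : ℕ} (P : MvPolynomial (Fin (n * n)) ℂ) (e : Fin n × Fin n ≃ Fin (n * n)) :
    aeval (fun j : Fin (n * n) => esymm (Fin (n * n)) ℂ (j.val + 1)) P =
      rename e (aeval (fun j : Fin (n * n) => esymm (Fin n × Fin n) ℂ (j.val + 1)) P) := by
  rw [← AlgHom.comp_apply, comp_aeval]
  have hfun : (fun j : Fin (n * n) => rename e (esymm (Fin n × Fin n) ℂ (j.val + 1))) =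
      fun j : Fin (n * n) => esymm (Fin (n * n)) ℂ (j.val + 1) := funext fun j => rename_esymm _ _ _ e
  rw [hfun]

/-- **Entry-symmetric cores of a `VQP` family form a `VQP` family** (Bläser–Jindal, polynomial form, at
`N = n²` variables). [cite: BlaserJindal2019, Thm. 4 and Remark (p. 47:3)] -/
theorem isVQPFamily_entrySymmetricCore (h : (n : ℕ) → MvPolynomial (Fin n × Fin n) ℂ)
    (P : (n : ℕ) → MvPolynomial (Fin (n * n)) ℂ)
    (hP : ∀ n, aeval (fun j : Fin (n * n) => esymm (Fin n × Fin n) ℂ (j.val + 1)) (P n) = h n)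
    (hh : IsVQPFamily h) : IsVQPFamily P := by
  obtain ⟨⟨_, hdeg⟩, hL⟩ := hh
  obtain ⟨c, hc⟩ := BlaserJindal2019_thm4_holds
  have e : ∀ n : ℕ, Fin n × Fin n ≃ Fin (n * n) := fun n => finProdFinEquiv
  have hcoreN : ∀ n, aeval (fun j : Fin (n * n) => esymm (Fin (n * n)) ℂ (j.val + 1)) (P n) =
      rename (e n) (h n) := fun n => by rw [rename_core_eq (P n) (e n), hP n]
  have hsq : IsPBounded fun n : ℕ => n * n := ⟨2, fun n => by show n * n ≤ n ^ 2 + 2; rw [pow_two]; omega⟩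
  refine ⟨⟨?_, ?_⟩, ?_⟩
  · exact hsq.mono fun n => by simp
  · refine hdeg.mono fun n => ?_
    calc (P n).totalDegree
        ≤ (aeval (fun j : Fin (n * n) => esymm (Fin (n * n)) ℂ (j.val + 1)) (P n)).totalDegree :=
          totalDegree_le_totalDegree_aeval_esymm (P n)
      _ ≤ (h n).totalDegree := by rw [hcoreN n]; exact totalDegree_rename_le _ _
  · have hq : IsQPBounded fun n => (complexity (h n) + (h n).totalDegree + n * n + 2) ^ c :=
      (((hL.add hdeg.isQPBounded).add hsq.isQPBounded).add (IsQPBounded.const 2)).pow c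
    refine hq.mono fun n => ?_
    have h1 := hc (n * n) (P n)
    rw [hcoreN n] at h1
    refine h1.trans (Nat.pow_le_pow_left ?_ c)
    have h2 : complexity (rename (e n) (h n)) ≤ complexity (h n) := complexity_rename_le_holds' _ _
    have h3 : (rename (e n) (h n)).totalDegree ≤ (h n).totalDegree := totalDegree_rename_le _ _
    omega

/-- ★ **The entry-symmetric stratum is narrow of quasi-polynomial length.**  Every `VQP` family of
polynomials `h_n ∈ ℂ[x_ij : i, j < n]` symmetric under ALL permutations of the `n²` entries satisfies the
conclusion of `stub_narrowExpressionCompression` (with `(1,1)` labels). [cite: BlaserJindal2019, Thm. 4] -/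
theorem narrowQP_entrySymmetric (h : (n : ℕ) → MvPolynomial (Fin n × Fin n) ℂ)
    (hsymm : ∀ n, (h n).IsSymmetric) (hh : IsVQPFamily h) :
    ∃ c : ℕ, ∀ n : ℕ, 1 ≤ n → ∃ (k l : ℕ) (e : PatternExpr ℂ k l),
      n ^ (k + l) ≤ 2 ^ ((Nat.log 2 n + c) ^ c) ∧ e.length ≤ 2 ^ ((Nat.log 2 n + c) ^ c) ∧
      e.close n = h n := by
  classical
  choose P hP using fun n => exists_entrySymmetricCore (h n) (hsymm n)
  have hPq : IsVQPFamily P := isVQPFamily_entrySymmetricCore h P hP hh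
  choose E hE using fun n : ℕ => exists_fullEsymm n (n * n)
  have hθ : ∃ c : ℕ, ∀ n : ℕ, 1 ≤ n → ∀ j : Fin (n * n),
      (E n (j.val + 1)).length ≤ 2 ^ ((Nat.log 2 n + c) ^ c) := by
    obtain ⟨c, hc⟩ := esymm_subst_length_qp 2
    refine ⟨c, fun n _ j => ?_⟩
    exact (hE n (j.val + 1) (by omega)).1.trans (hc n (n * n) (by nlinarith))
  obtain ⟨c₁, hc₁⟩ := exists_narrow_subst_of_isVQPFamily (m := fun n => n * n) P hPq
    (k := fun _ => 1) (l := fun _ => 1) (fun n j => E n (j.val + 1)) hθ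
  obtain ⟨c₂, hc₂⟩ := NarrowClosure.qp_combine c₁ 0
  refine ⟨max c₂ 3, fun n hn => ?_⟩
  obtain ⟨e, hl, hv⟩ := hc₁ n hn
  have hval : ∀ (ρ γ : Fin 1 → Fin n), e.value n ρ γ = h n := by
    intro ρ γ
    have hfun : (fun j : Fin (n * n) => (E n (j.val + 1)).value n ρ γ) =
        fun j : Fin (n * n) => esymm (Fin n × Fin n) ℂ (j.val + 1) := by
      funext j
      rw [(hE n (j.val + 1) (by omega)).2 ρ γ]
      exact aeval_X_left_apply _
    rw [hv, hfun, hP n]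
  obtain ⟨e', hl', hc'⟩ := exists_close_eq_of_value_const hn e _ hval
  refine ⟨1, 1, e', ?_, ?_, hc'⟩
  · calc n ^ (1 + 1) ≤ n ^ 2 + 2 := by norm_num
      _ ≤ 2 ^ ((Nat.log 2 n + 3) ^ 3) := CompressionFloors.pbounded_le_qp n 2
      _ ≤ 2 ^ ((Nat.log 2 n + max c₂ 3) ^ max c₂ 3) :=
          Nat.pow_le_pow_right (by norm_num) (CompressionFloors.polylog_mono (le_max_right _ _))
  · have h2 := hc₂ (Nat.log 2 n) e.length 0 hl (by simp)
    calc e'.length = e.length + 2 := hl'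
      _ ≤ (e.length + 2) * (0 + 2) := by omega
      _ ≤ 2 ^ ((Nat.log 2 n + c₂) ^ c₂) := h2
      _ ≤ 2 ^ ((Nat.log 2 n + max c₂ 3) ^ max c₂ 3) :=
          Nat.pow_le_pow_right (by norm_num) (CompressionFloors.polylog_mono (le_max_left _ _))

end FormulaSubstitution

end Summit.ValiantsHypothesis.ValiantsHypothesis.Theorems

end
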